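import Summits.BirchSwinnertonDyer.BirchSwinnertonDyer.Theorems.KimAtThreeFineKatoDefinedLambdaUnique
import Summits.BirchSwinnertonDyer.BirchSwinnertonDyer.Theorems.KimAtThreeFineKatoExpStarGaloisConj
import Summits.BirchSwinnertonDyer.BirchSwinnertonDyer.Theorems.KimAtThreeFineKatoValueEquivarianceLocal
import HarnessLib

/-!
# Kato's value datum DEFINED, VII — **`katoLambda` does not depend on the twist family**: for the DEFINED
# `exp*_{w₀} ∘ loc^{tower}_{w₀}` the stabiliser equivariance (GAL₀) is KERNEL (kim3 `expStarOmega_galois` ∘ w2-acc5 g5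
# `galD_of_galLoc` ∘ `singleField_gal_of_galDecomposition_all`), so `KimAtThreeFineKatoDefinedLambdaUnique.definedLambda_eq_of_galStab`
# applies (crux `KatoKuriharaPortThreeShared`, stmt-BirchSwinnertonDyer-19560; cell `bsd-addord`, seat w2-acc5 gen 6; `--supports 19560`, helper)

HONEST FRAMING.  ONE TOOL theorem (no definition, no named fact, no instance, no `sorry`); every `p`, `k`, `r`; closes nothing;
nothing is booked; BSD is not proved by any of this.

WHAT.  `katoLambda_eq_of_twist`: for a line datum `d` at `ℚ_{v_p}` with ONE class `y`, `exp*_d y ≠ 0` (on the Kato stratum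
at `p = 3`: kim3 `forall_norm_mul_padicLog_le_one_iff_three`; on every row from (S5b): w2-c3
`exists_expStarOmegaAt_ne_zero_of_facts`), a chart `(Ψ, w₀, dw)` with (RES₀), and TWO twist families `g, g'`
(`g̃_w • w = w₀ = g̃'_w • w`): **`katoLambda … g hg dw … = katoLambda … g' hg' dw …`**.  Half of «the defined datum is
CANONICAL given (RES₀)»: the `∃ g` of `hKatoDef` / the `∀ g` of `hKatoDefAll` (`KimAtThreeFineKatoDefinedLambdaKatoV2` /
`…Charts`) are immaterial.  The other half — independence of the place `w₀` — needs the transport of `exp*` between two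
completions `L_{w₀} ≅ L_{w₀'}` (w2-c2 `ExpStarOmegaTransport` along `galAdicCompletionEquiv`) and is NOT in this file.

References: K. Kato, Astérisque 295 (2004) §9.4 [Kato2004Asterisque]; K. Kato, LNM 1553 (1993) II §1.2.4, Prop. 1.2.3
[Kato1993LNM1553]; J. Neukirch, *ANT* (1999) I §9, II §9 (9.6) [NeukirchANT1999]; J.-P. Serre, *Local Fields* (1979) VII §5
[SerreLocalFields1979]; J. W. S. Cassels, A. Fröhlich (1967) Ch. VII §1.1 [CasselsFrohlichANT1967].
-/

noncomputable section

-- the cell's Theorems namespace `Summit.BirchSwinnertonDyer.BirchSwinnertonDyer.…` repeats the summit name by design (D-0017)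
set_option linter.dupNamespace false

open scoped Classical NumberField ContRepresentation TensorProduct Pointwise
open Field ValuativeRel NumberField IsDedekindDomain
open WeierstrassCurve Literature.NumberTheory.EllipticCurves Literature.NumberTheory.GaloisRepresentations
  Literature.NumberTheory.GaloisRepresentations.DiscreteGaloisModule
  Literature.NumberTheory.EllipticCurves.Kato2004.EulerSystemValues
open Literature.NumberTheory.GaloisRepresentations.PeriodRingData Literature.NumberTheory.PAdicHodge
open Literature.NumberTheory.AdelicBaseChange Literature.NumberTheory.Automorphic
open Summit.BirchSwinnertonDyer.Rank1Residual.GaloisImage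
open Summit.BirchSwinnertonDyer.BirchSwinnertonDyer.Theorems.KimAtThreeFineKatoLevelCompat
open Summit.BirchSwinnertonDyer.BirchSwinnertonDyer.Theorems.KimAtThreeFineKatoLevelCompatDef
open Summit.BirchSwinnertonDyer.BirchSwinnertonDyer.Theorems.KimAtThreeDeepLowerExpStarOmega
open Summit.BirchSwinnertonDyer.BirchSwinnertonDyer.Theorems.KimAtThreeDeepLowerExpStarOmegaPlace
open Summit.BirchSwinnertonDyer.BirchSwinnertonDyer.Theorems.KimAtThreeDeepLowerExpStarOmegaRes
open Summit.BirchSwinnertonDyer.BirchSwinnertonDyer.Theorems.KimAtThreeFineKatoExpStarGalois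
open Summit.BirchSwinnertonDyer.BirchSwinnertonDyer.Theorems.KimAtThreeFineKatoValueEquivarianceStabAll
open Summit.BirchSwinnertonDyer.BirchSwinnertonDyer.Theorems.KimAtThreeFineKatoValueEquivarianceLocal
open Summit.BirchSwinnertonDyer.BirchSwinnertonDyer.Theorems.KimAtThreeFineKatoDefinedLambda
open Summit.BirchSwinnertonDyer.BirchSwinnertonDyer.Theorems.KimAtThreeFineKatoDefinedLambdaUnique

namespace Summit.BirchSwinnertonDyer.BirchSwinnertonDyer.Theorems.KimAtThreeFineKatoDefinedLambdaTwist

variable (W : WeierstrassCurve ℚ) [W.IsElliptic] (p : ℕ) [hp : Fact p.Prime]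
  [ContinuousSMul ℤ_[p] (W.tateModule p)] (k : ℕ) (r : Finset (HeightOneSpectrum (𝓞 ℚ)))
  (Ψ : ℚ_[p] ⊗[ℚ] CyclotomicField (cycLevel p k r) ℚ ≃ₐ[ℚ]
    (Π w : ((Rat.HeightOneSpectrum.primesEquiv (R := 𝓞 ℚ)).symm ⟨p, Fact.out⟩).Extension (𝓞 (CyclotomicField (cycLevel p k r) ℚ)), w.1.adicCompletion (CyclotomicField (cycLevel p k r) ℚ)))
  (hΨ : ∀ (s : ℚ_[p]) (x : CyclotomicField (cycLevel p k r) ℚ) (w : ((Rat.HeightOneSpectrum.primesEquiv (R := 𝓞 ℚ)).symm ⟨p, Fact.out⟩).Extension (𝓞 (CyclotomicField (cycLevel p k r) ℚ))),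
    Ψ (s ⊗ₜ[ℚ] x) w = algebraMap (CyclotomicField (cycLevel p k r) ℚ) (w.1.adicCompletion (CyclotomicField (cycLevel p k r) ℚ)) x *
      algebraMap (((Rat.HeightOneSpectrum.primesEquiv (R := 𝓞 ℚ)).symm ⟨p, Fact.out⟩).adicCompletion ℚ) (w.1.adicCompletion (CyclotomicField (cycLevel p k r) ℚ)) (Padic.adicCompletionEquiv (𝓞 ℚ) ⟨p, Fact.out⟩ s))
  (w₀ : ((Rat.HeightOneSpectrum.primesEquiv (R := 𝓞 ℚ)).symm ⟨p, Fact.out⟩).Extension (𝓞 (CyclotomicField (cycLevel p k r) ℚ)))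
  (hw₀ : ((p : ℕ) : 𝓞 (CyclotomicField (cycLevel p k r) ℚ)) ∈ w₀.1.asIdeal)
  (g g' : ((Rat.HeightOneSpectrum.primesEquiv (R := 𝓞 ℚ)).symm ⟨p, Fact.out⟩).Extension (𝓞 (CyclotomicField (cycLevel p k r) ℚ)) → absoluteGaloisGroup ℚ)
  (hg : ∀ w : ((Rat.HeightOneSpectrum.primesEquiv (R := 𝓞 ℚ)).symm ⟨p, Fact.out⟩).Extension (𝓞 (CyclotomicField (cycLevel p k r) ℚ)), sigma (cycLevel p k r) (modNCyclotomicCharacter ℚ (cycLevel p k r) (g w)) • w.1 = w₀.1)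
  (hg' : ∀ w : ((Rat.HeightOneSpectrum.primesEquiv (R := 𝓞 ℚ)).symm ⟨p, Fact.out⟩).Extension (𝓞 (CyclotomicField (cycLevel p k r) ℚ)), sigma (cycLevel p k r) (modNCyclotomicCharacter ℚ (cycLevel p k r) (g' w)) • w.1 = w₀.1)

set_option backward.isDefEq.respectTransparency false in
set_option maxHeartbeats 800000 in
/-- **`katoLambda` does not depend on the twist family** (module docstring): under (RES₀) for `(d, dw)` and one class with
`exp*_d ≠ 0`, the defined datum built with `g` equals the one built with `g'`.  Proof: `definedLambda_eq_of_galStab` with the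
stabiliser equivariance (GAL₀) of `F := exp*_{w₀} ∘ loc^{tower}_{w₀} ∘ H1toInt` supplied by
`singleField_gal_of_galDecomposition_all` ∘ `galD_of_galLoc` ∘ kim3's `expStarOmega_galois` (conjugations from
`exists_conjTransport`, `L_{w₀}/ℚ_v` Galois; `hg` of (GAL_loc) = `absClosureEmbedding_smul_eq_galAdicCompletionMap`; scalar tower
`ℚ_p → ℚ_v → L_{w₀}` by `isScalarTower_padicAlgebra_of_continuous`) — the assembly of kim3's `zetaBody_C3_of_level`, at every `p`
(`maxHeartbeats 800000`: the displayed chart binders plus the (GAL_loc) instantiation in one proof).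
[cite: Kato2004Asterisque, §9.4 (p. 188)] [cite: Kato1993LNM1553, Ch. II §1.2.4 and Prop. 1.2.3]
[cite: NeukirchANT1999, Ch. II §9 Prop. (9.6)] [cite: SerreLocalFields1979, VII §5 Prop. 3] [cite: CasselsFrohlichANT1967, Ch. VII §1.1] -/
theorem katoLambda_eq_of_twist :
    haveI : Fact (((p : ℕ) : 𝓞 ℚ) ∈ ((Rat.HeightOneSpectrum.primesEquiv (R := 𝓞 ℚ)).symm ⟨p, Fact.out⟩).asIdeal) := ⟨(natCast_mem_asIdeal_iff_eq_primesEquiv_symm _ hp.out).mpr rfl⟩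
    letI := valuativeRelPlace ((Rat.HeightOneSpectrum.primesEquiv (R := 𝓞 ℚ)).symm ⟨p, Fact.out⟩)
    letI := topologicalSpacePlace ((Rat.HeightOneSpectrum.primesEquiv (R := 𝓞 ℚ)).symm ⟨p, Fact.out⟩)
    haveI := isNonarchimedeanLocalField_place ((Rat.HeightOneSpectrum.primesEquiv (R := 𝓞 ℚ)).symm ⟨p, Fact.out⟩)
    haveI := charZero_place ((Rat.HeightOneSpectrum.primesEquiv (R := 𝓞 ℚ)).symm ⟨p, Fact.out⟩)
    letI := padicAlgebraPlace p ((Rat.HeightOneSpectrum.primesEquiv (R := 𝓞 ℚ)).symm ⟨p, Fact.out⟩)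
    haveI := fact_not_isUnit_place p ((Rat.HeightOneSpectrum.primesEquiv (R := 𝓞 ℚ)).symm ⟨p, Fact.out⟩)
    haveI := isAdicComplete_place p ((Rat.HeightOneSpectrum.primesEquiv (R := 𝓞 ℚ)).symm ⟨p, Fact.out⟩)
    ∀ (d : LocalNeronLineAt W p ((Rat.HeightOneSpectrum.primesEquiv (R := 𝓞 ℚ)).symm ⟨p, Fact.out⟩))
      (hinj : (bdRPeriodRingData (valuation_place_lt_one p ((Rat.HeightOneSpectrum.primesEquiv (R := 𝓞 ℚ)).symm ⟨p, Fact.out⟩))).CupLogInjective (logCyclotomic p)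
        (localRationalTateRep W p (galRestrictPlace ((Rat.HeightOneSpectrum.primesEquiv (R := 𝓞 ℚ)).symm ⟨p, Fact.out⟩))))
      (hex : ∀ z : contOneCocycles (localRationalTateRep W p (galRestrictPlace ((Rat.HeightOneSpectrum.primesEquiv (R := 𝓞 ℚ)).symm ⟨p, Fact.out⟩))).toTopRep,
        (bdRPeriodRingData (valuation_place_lt_one p ((Rat.HeightOneSpectrum.primesEquiv (R := 𝓞 ℚ)).symm ⟨p, Fact.out⟩))).HasDualExp (logCyclotomic p)
          (localRationalTateRep W p (galRestrictPlace ((Rat.HeightOneSpectrum.primesEquiv (R := 𝓞 ℚ)).symm ⟨p, Fact.out⟩))) fun σ => z.1 σ),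
    (∃ y, expStarOmegaAt d y ≠ 0) →
    letI := LocalField.charZero_adicCompletion w₀.1
    letI := LocalField.adicCompletionPadicAlgebra w₀.1 p hw₀
    haveI : Fact (¬ IsUnit ((p : ℕ) : integerC (w₀.1.adicCompletion (CyclotomicField (cycLevel p k r) ℚ)))) := ⟨not_isUnit_natCast_integerC (LocalField.valuation_adicCompletion_natCast_lt_one w₀.1 p hw₀)⟩
    haveI := isAdicComplete_integerC_natCast (LocalField.valuation_adicCompletion_natCast_lt_one w₀.1 p hw₀)
    ∀ (dw : LocalNeronLine W (LocalField.valuation_adicCompletion_natCast_lt_one w₀.1 p hw₀) ((galRestrictPlace ((Rat.HeightOneSpectrum.primesEquiv (R := 𝓞 ℚ)).symm ⟨p, Fact.out⟩)).comp (absGaloisRestrict (((Rat.HeightOneSpectrum.primesEquiv (R := 𝓞 ℚ)).symm ⟨p, Fact.out⟩).adicCompletion ℚ) (w₀.1.adicCompletion (CyclotomicField (cycLevel p k r) ℚ)))))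
      (hinjw : (bdRPeriodRingData (LocalField.valuation_adicCompletion_natCast_lt_one w₀.1 p hw₀)).CupLogInjective (logCyclotomic p) (localRationalTateRep W p ((galRestrictPlace ((Rat.HeightOneSpectrum.primesEquiv (R := 𝓞 ℚ)).symm ⟨p, Fact.out⟩)).comp (absGaloisRestrict (((Rat.HeightOneSpectrum.primesEquiv (R := 𝓞 ℚ)).symm ⟨p, Fact.out⟩).adicCompletion ℚ) (w₀.1.adicCompletion (CyclotomicField (cycLevel p k r) ℚ))))))
      (hexw : ∀ z : contOneCocycles (localRationalTateRep W p ((galRestrictPlace ((Rat.HeightOneSpectrum.primesEquiv (R := 𝓞 ℚ)).symm ⟨p, Fact.out⟩)).comp (absGaloisRestrict (((Rat.HeightOneSpectrum.primesEquiv (R := 𝓞 ℚ)).symm ⟨p, Fact.out⟩).adicCompletion ℚ) (w₀.1.adicCompletion (CyclotomicField (cycLevel p k r) ℚ))))).toTopRep,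
        (bdRPeriodRingData (LocalField.valuation_adicCompletion_natCast_lt_one w₀.1 p hw₀)).HasDualExp (logCyclotomic p) (localRationalTateRep W p ((galRestrictPlace ((Rat.HeightOneSpectrum.primesEquiv (R := 𝓞 ℚ)).symm ⟨p, Fact.out⟩)).comp (absGaloisRestrict (((Rat.HeightOneSpectrum.primesEquiv (R := 𝓞 ℚ)).symm ⟨p, Fact.out⟩).adicCompletion ℚ) (w₀.1.adicCompletion (CyclotomicField (cycLevel p k r) ℚ))))) fun σ => z.1 σ),
    (∀ (h : (tateLocalRep W p (Sum.inr ((Rat.HeightOneSpectrum.primesEquiv (R := 𝓞 ℚ)).symm ⟨p, Fact.out⟩))).cohomology 1),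
      expStarOmegaHom (LocalField.valuation_adicCompletion_natCast_lt_one w₀.1 p hw₀) ((galRestrictPlace ((Rat.HeightOneSpectrum.primesEquiv (R := 𝓞 ℚ)).symm ⟨p, Fact.out⟩)).comp (absGaloisRestrict (((Rat.HeightOneSpectrum.primesEquiv (R := 𝓞 ℚ)).symm ⟨p, Fact.out⟩).adicCompletion ℚ) (w₀.1.adicCompletion (CyclotomicField (cycLevel p k r) ℚ)))) dw hinjw hexw
        (ContinuousRep.cohomologyRes (tateLocalRep W p (Sum.inr ((Rat.HeightOneSpectrum.primesEquiv (R := 𝓞 ℚ)).symm ⟨p, Fact.out⟩))) (absGaloisRestrict (((Rat.HeightOneSpectrum.primesEquiv (R := 𝓞 ℚ)).symm ⟨p, Fact.out⟩).adicCompletion ℚ) (w₀.1.adicCompletion (CyclotomicField (cycLevel p k r) ℚ))) 1 h) =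
      algebraMap (((Rat.HeightOneSpectrum.primesEquiv (R := 𝓞 ℚ)).symm ⟨p, Fact.out⟩).adicCompletion ℚ) (w₀.1.adicCompletion (CyclotomicField (cycLevel p k r) ℚ)) (expStarOmegaAt d h)) →
    katoLambda W p k r w₀ Ψ hΨ hw₀ g hg dw hinjw hexw = katoLambda W p k r w₀ Ψ hΨ hw₀ g' hg' dw hinjw hexw := by
  haveI : Fact (((p : ℕ) : 𝓞 ℚ) ∈ ((Rat.HeightOneSpectrum.primesEquiv (R := 𝓞 ℚ)).symm ⟨p, Fact.out⟩).asIdeal) := ⟨(natCast_mem_asIdeal_iff_eq_primesEquiv_symm _ hp.out).mpr rfl⟩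
  letI := valuativeRelPlace ((Rat.HeightOneSpectrum.primesEquiv (R := 𝓞 ℚ)).symm ⟨p, Fact.out⟩)
  letI := topologicalSpacePlace ((Rat.HeightOneSpectrum.primesEquiv (R := 𝓞 ℚ)).symm ⟨p, Fact.out⟩)
  haveI := isNonarchimedeanLocalField_place ((Rat.HeightOneSpectrum.primesEquiv (R := 𝓞 ℚ)).symm ⟨p, Fact.out⟩)
  haveI := charZero_place ((Rat.HeightOneSpectrum.primesEquiv (R := 𝓞 ℚ)).symm ⟨p, Fact.out⟩)
  letI := padicAlgebraPlace p ((Rat.HeightOneSpectrum.primesEquiv (R := 𝓞 ℚ)).symm ⟨p, Fact.out⟩)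
  haveI := fact_not_isUnit_place p ((Rat.HeightOneSpectrum.primesEquiv (R := 𝓞 ℚ)).symm ⟨p, Fact.out⟩)
  haveI := isAdicComplete_place p ((Rat.HeightOneSpectrum.primesEquiv (R := 𝓞 ℚ)).symm ⟨p, Fact.out⟩)
  intro d hinj hex hne
  letI := LocalField.charZero_adicCompletion w₀.1
  letI := LocalField.adicCompletionPadicAlgebra w₀.1 p hw₀
  haveI : Fact (¬ IsUnit ((p : ℕ) : integerC (w₀.1.adicCompletion (CyclotomicField (cycLevel p k r) ℚ)))) := ⟨not_isUnit_natCast_integerC (LocalField.valuation_adicCompletion_natCast_lt_one w₀.1 p hw₀)⟩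
  haveI := isAdicComplete_integerC_natCast (LocalField.valuation_adicCompletion_natCast_lt_one w₀.1 p hw₀)
  intro dw hinjw hexw hresw
  -- `Place.Completion (inr v)` IS `ℚ_v`: the packet's algebra structure on it (the currency of the (GAL) lemmas)
  letI instEF : Algebra (NumberField.Place.Completion (K := ℚ) (Sum.inr ((Rat.HeightOneSpectrum.primesEquiv (R := 𝓞 ℚ)).symm ⟨p, Fact.out⟩))) (w₀.1.adicCompletion (CyclotomicField (cycLevel p k r) ℚ)) :=
    inferInstanceAs (Algebra (((Rat.HeightOneSpectrum.primesEquiv (R := 𝓞 ℚ)).symm ⟨p, Fact.out⟩).adicCompletion ℚ) (w₀.1.adicCompletion (CyclotomicField (cycLevel p k r) ℚ)))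
  -- Galois bookkeeping: `L_{w₀}/ℚ_v` is Galois, so conjugations by `δ' ∈ Γ_{ℚ_v}` transport to `Γ_{L_{w₀}}`
  haveI hGal : IsGalois (NumberField.Place.Completion (K := ℚ) (Sum.inr ((Rat.HeightOneSpectrum.primesEquiv (R := 𝓞 ℚ)).symm ⟨p, Fact.out⟩))) (w₀.1.adicCompletion (CyclotomicField (cycLevel p k r) ℚ)) :=
    isGalois_adicCompletion_cyclotomicField (cycLevel p k r) ((Rat.HeightOneSpectrum.primesEquiv (R := 𝓞 ℚ)).symm ⟨p, Fact.out⟩) w₀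
  have hconj := fun δ' : absoluteGaloisGroup (NumberField.Place.Completion (K := ℚ) (Sum.inr ((Rat.HeightOneSpectrum.primesEquiv (R := 𝓞 ℚ)).symm ⟨p, Fact.out⟩))) =>
    exists_conjTransport (K := NumberField.Place.Completion (K := ℚ) (Sum.inr ((Rat.HeightOneSpectrum.primesEquiv (R := 𝓞 ℚ)).symm ⟨p, Fact.out⟩))) (L := (w₀.1.adicCompletion (CyclotomicField (cycLevel p k r) ℚ))) δ'
  choose s hs using hconj
  -- the continuous inclusion `ℚ_v → L_{w₀}` and the scalar tower of the canonical `ℚ_p`-structures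
  have hcont : Continuous (algebraMap (NumberField.Place.Completion (K := ℚ) (Sum.inr ((Rat.HeightOneSpectrum.primesEquiv (R := 𝓞 ℚ)).symm ⟨p, Fact.out⟩))) (w₀.1.adicCompletion (CyclotomicField (cycLevel p k r) ℚ))) :=
    continuous_algebraMap (((Rat.HeightOneSpectrum.primesEquiv (R := 𝓞 ℚ)).symm ⟨p, Fact.out⟩).adicCompletion ℚ) (w₀.1.adicCompletion (CyclotomicField (cycLevel p k r) ℚ))
  haveI hSTp : IsScalarTower ℚ_[p] (NumberField.Place.Completion (K := ℚ) (Sum.inr ((Rat.HeightOneSpectrum.primesEquiv (R := 𝓞 ℚ)).symm ⟨p, Fact.out⟩))) (w₀.1.adicCompletion (CyclotomicField (cycLevel p k r) ℚ)) :=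
    isScalarTower_padicAlgebra_of_continuous p hcont (valuation_place_lt_one p ((Rat.HeightOneSpectrum.primesEquiv (R := 𝓞 ℚ)).symm ⟨p, Fact.out⟩)) (LocalField.valuation_adicCompletion_natCast_lt_one w₀.1 p hw₀)
  -- one class with `exp*_d ≠ 0`
  obtain ⟨y₁, hy₁⟩ := hne
  have hh₀ : expStarOmega (valuation_place_lt_one p ((Rat.HeightOneSpectrum.primesEquiv (R := 𝓞 ℚ)).symm ⟨p, Fact.out⟩)) (galRestrictPlace ((Rat.HeightOneSpectrum.primesEquiv (R := 𝓞 ℚ)).symm ⟨p, Fact.out⟩)) d y₁ ≠ 0 := hy₁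
  -- (GAL_D) for `φ₀ := exp*_{w₀}` from kim3's (GAL_loc)
  have hgalD := galD_of_galLoc W p k r w₀ (absGaloisRestrictTower_adicCompletion_mem_cycSubgroup_prime p k r w₀)
    (expStarOmegaHom (LocalField.valuation_adicCompletion_natCast_lt_one w₀.1 p hw₀) ((galRestrictPlace ((Rat.HeightOneSpectrum.primesEquiv (R := 𝓞 ℚ)).symm ⟨p, Fact.out⟩)).comp (absGaloisRestrict (((Rat.HeightOneSpectrum.primesEquiv (R := 𝓞 ℚ)).symm ⟨p, Fact.out⟩).adicCompletion ℚ) (w₀.1.adicCompletion (CyclotomicField (cycLevel p k r) ℚ)))) dw hinjw hexw) (fun δ' τ => s δ' τ) hs (fun δ' hδ c c' hc' =>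
      expStarOmega_galois (K := NumberField.Place.Completion (K := ℚ) (Sum.inr ((Rat.HeightOneSpectrum.primesEquiv (R := 𝓞 ℚ)).symm ⟨p, Fact.out⟩))) (L := (w₀.1.adicCompletion (CyclotomicField (cycLevel p k r) ℚ))) (p := p)
        (valuation_place_lt_one p ((Rat.HeightOneSpectrum.primesEquiv (R := 𝓞 ℚ)).symm ⟨p, Fact.out⟩)) (LocalField.valuation_adicCompletion_natCast_lt_one w₀.1 p hw₀) W (galRestrictPlace ((Rat.HeightOneSpectrum.primesEquiv (R := 𝓞 ℚ)).symm ⟨p, Fact.out⟩)) hcont δ' (s δ') (hs δ')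
        (galAdicCompletionMap _ hδ)
        (fun x => galAdicCompletionMap_algebraMap_adicCompletion _ _ w₀ w₀ hδ x)
        (fun y x hyx => absClosureEmbedding_smul_eq_galAdicCompletionMap p k r w₀ δ' hδ y x hyx)
        d dw hinjw hexw (fun y => hresw y) y₁ hh₀ c c' (fun τ => hc' τ))
  -- (GAL_D) read on `F := exp*_{w₀} ∘ loc^{tower} ∘ H1toInt = expStarTowerMap` (no re-elaboration of `loc^{tower}` here:
  -- `Algebra ℚ ℚ_v` must stay the packet's, not `DivisionRing.toRatAlgebra`)
  have hgalD' := fun δ' hδ' Y' =>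
    ((expStarTowerMap_apply W p k r w₀ hw₀ dw hinjw hexw _).trans (hgalD δ' hδ' Y')).trans
      (congrArg (galAdicCompletionMap _ hδ') (expStarTowerMap_apply W p k r w₀ hw₀ dw hinjw hexw Y').symm)
  -- (GAL₀) at every `δ ∈ Γ_ℚ` fixing `w₀`, then `definedLambda_eq_of_galStab`
  refine definedLambda_eq_of_galStab W p k r Ψ w₀ (expStarTowerMap W p k r w₀ hw₀ dw hinjw hexw) g g' hg hg' ?_ hΨ
    (expStarTowerMap_smul W p k r w₀ hw₀ dw hinjw hexw)
  intro δ hδ Y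
  exact singleField_gal_of_galDecomposition_all p k r W w₀ (expStarTowerMap W p k r w₀ hw₀ dw hinjw hexw)
    (fun δ' hδ' Y' => hgalD' δ' hδ' Y') δ hδ Y

end Summit.BirchSwinnertonDyer.BirchSwinnertonDyer.Theorems.KimAtThreeFineKatoDefinedLambdaTwist

end
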